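import Summits.QuantumFields.BalabanUV.T4Continuum.Spine.NE1p.DressedSmallFieldFamilyAmplitude

/-!
# T⁴ programme, spine estimate NE1′ (node O3b/H2) — THE SECOND RESUMMATION STEP OF (B3)'s COUNT, TABLE-BLIND: at a fixed scale-`k`
# domain `Z₀` the count over the inner labels `(Y₀, 𝐃, P)` — Mayer subfamily `𝐃` covering `Y₀ ⊆ Z₀`, bond set `P` outside `Y₀` with
# `#(Z₀∖Y₀) ≤ 2·#P` — of the majorant `(Π_{Y∈𝐃} α₆e^{−δκd_k Y}·e^{−R(d_k Y+5)})·(s²t)^{#P}` is `≤ e^{c₁u−5R}·e^{−(R−c₁u)·d_k(Z₀)}`,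
# `u := e^{Rc₃₂}·s·e^{b₀t}` — [Balaban1988RGII] (2.31)–(2.34) KIND, b13's `B13.sum_powerset_le_exp_234` and N0s's count BY NAME

Cell `pub-balaban`, sub-cell `t4`, BINDER-OWNERS row NE1′; owner lineage t4-ne1p-p1 (PROVER seat P1, «RG-trajectory comparison …
μ-uniformity through the printed small-field bounds»), generation 29; ADDITIVE — imports the owner's N0t
`Spine/NE1p/DressedSmallFieldFamilyAmplitude` ONLY (→ N0s → N0r → …; b13's `B13.lean` ∕ `B13FamilySum` in the cone); THEOREMS ONLY
(0 def, 0 `def … : Prop`, 0 cite); nothing of N0s ∕ b13's modules is restated — `sum_powerset_le_exp_234`, `count_coveringFamilies`,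
`ineq229_locDomainSys`, `attachedPart_locE_le_of_coresAt_pencil_count` are used BY NAME.

WHY THIS FILE.  N0s made (B3) = amplitude × TABLE-BLIND count and supplied the FIRST of print's four resummation steps (the 𝐃-sum at
fixed Y₀, (2.27)∕(2.29)) by name, in the sub-case «Y₀ = Z₀ = Z».  Print's SECOND step (p. 17: «Next, we sum over Y₀, P determining a
fixed Z₀») is combinatorics of the same table-blind kind, pp. 18–19: «Now we consider the sum over Y₀, P, with fixed Z₀. It is
controlled by the exponential factor with |P| in (2.26). The definition of Z₀ yields |P| ≥ ½M⁻⁴|Z₀∖Y₀|, because one bond in P may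
connect two cubes in Z₀∖Y₀. We decompose the exponential factor into a product of five equal factors. Four of them are bounded
using the above inequality, the fifth is used to bound the sum over P, with a fixed Y₀.» (2.31); «By a simple geometric argument we
have Σ_i d_k(Y_i) + 4M⁻⁴|Z₀∖Y₀| ≥ d_k(Z₀). (2.32)»; (2.33); «Finally, we have the sum over Y₀ ⊂ Z₀, or over Z₀∖Y₀. The remaining factor
is used to bound this sum Σ_{Z₀∖Y₀} exp(−(1∕20)γ₂(ε₁²∕g_k²)M⁻⁴|Z₀∖Y₀|) ≤ exp(exp(−(1∕20)γ₂ε₁²∕γ²)M⁻⁴|Z₀|). (2.34) The exponential on the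
right-hand side multiplied by exp(−δκd_k(Z₀)) can be estimated by 1.» (p. 12: «for a fixed domain Y₀ we define the set of bonds
Y₀^{c*} = {b∈T^{(k)}: b ⊂ Y₀ᶜ}∖{b₀(c): c∈T^{(k+1)}}», (2.3): `P ⊂ Y₀^{c*}` — the bonds lie OUTSIDE Y₀).  Here, on the cell's format,
with the uncovered cube set `W = Z₀∖Y₀` as the label's first component:
* §1 `sum_bondSets_le` [arith] — the P-STEP: `Σ_{P ⊆ B, n ≤ 2#P} (s²t)^{#P} ≤ sⁿ·e^{#B·t}` (two letters `s` per bond pay `sⁿ`, the rest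
  is b13's `sum_powerset_le_exp_234` BY NAME).
* §2 `fibre_le` — ONE fibre `W`: N0s's `count_coveringFamilies` for the coverings of `C₀∖W` under the (2.27)∘(2.32)-KIND LINK
  `dZ₀ + 5 ≤ Σ_{Y∈𝐃}(d_k Y + 5) + c₃₂·#W` (displayed; print's (2.32) constant `4`, the tree's repaired `17` for the formalised tree length
  `B13Ineq232TreeLength.ineq232_treeLen`, GAPS G-B13-08) × §1 with `#bondsOf W ≤ b₀·#W` ⇒ `≤ e^{−R(dZ₀+5)}·u^{#W}`,
  `u := e^{Rc₃₂}·s·e^{b₀t}`; **`innerCount_le`** — labels `⟨W, (𝐃, P)⟩` with `W ⊆ C₀`, `𝐃 ∈ coveringFamilies S cubesK (C₀∖W)`,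
  `P ⊆ bondsOf W`, `#W ≤ 2#P` (`hadm`), ANY sub-collection `terms`: the sum splits fibrewise (`Finset.sum_sigma`, `Finset.sum_product`,
  `Finset.sum_mul_sum`) and `Σ_{W⊆C₀} u^{#W} ≤ e^{#C₀·u}` is (2.34) — `sum_powerset_le_exp_234` BY NAME again: total `≤ e^{−R(dZ₀+5)}·e^{#C₀u}`;
  **`innerCount_le_decay`** — with the additive volume bound `#C₀ ≤ c₁(1 + dZ₀)` ((2.30) KIND): `≤ e^{c₁u − 5R}·e^{−(R − c₁u)dZ₀}` —
  the entropy of the uncovered cubes costs the rate `c₁u` and the constant is paid by print's `+5`.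
* §3 **`attachedPart_locE_le_of_coresAt_pencil_innerLabels`** — N0s's `attachedPart_locE_le_of_coresAt_pencil_count` ONCE BY NAME at the
  inner-label index, `hCount` SUPPLIED by §2 on the (2.11)-geometry `Gk` one scale down ((2.29) by `ineq229_locDomainSys`, volume bound
  `Gk.volBound (foot Z)`), with the rate bookkeeping `Rkp ≤ R − c₁u` (whence `0 ≤ R`, `c₁u ≤ 5R`) and `hmono`; displayed of (B3): `hadm` (terms of `Z` =
  inner labels of `foot Z` — (B1b) READING, sub-case «Z′₀ = Z, one component»), the per-label AMPLITUDE `hAmp`, `hlink`, `hb₀`, the clauses.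

WHAT THIS DOES TO THE WALL (owner's reading; nothing re-labelled; joins Q47).  (B3-count) now holds the FIRST AND SECOND of print's four
resummation steps in kernel on the cell's format — table-blind, μ-FREE by construction — leaving of printed KIND only the Z₀-components ∕
Z′₀-steps ((2.35)–(2.37), scale transfer) and the LINK `hlink` ((2.27)∘(2.32): tree pieces `Geometry.ineq227`, `B13Ineq232TreeLength`);
(B3-form)∕(B3-arith) as N0t.  NOTHING of (B3) is discharged on Bałaban's densities; `hadm`∕`foot`∕`bondsOf` are (B1b)-READING
identifications (the labels of record are NE5's `B13StepTermLabels.InnerLabel := ⟨Z₀, fam, P⟩`); 0 binders instantiated on Bałaban's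
(2.14) data; wall v1.7 does NOT move; NE1′ NOT printed, NOT proved; 0∕9; count 9 unchanged.

HONEST FRAMING.  Finite combinatorics + real arithmetic ([folklore]∕[arith]) and one by-name application of N0s's END; the quotations
above are LOCI of the audited manuscript [Balaban1988RGII] = CMP 116 (1988) 1–22 (renders `…-p012∕p017∕p018∕p019-x2.png` read as images
this generation), TYPE∕CONTEXT only, never hypothesis-free facts; ABSOLUTE RULE honoured; nothing internally minted is cited.  Rung (B)+1 on
ONE finite T⁴ — NOT infinite volume, NOT a mass gap, NOT OS on ℝ⁴, NOT Clay.  HONEST DEPENDENCY: continuum YM on T⁴ ⇐ BetaPertH ∧ nine spine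
estimates (0/9 proved); BetaPertH ⇐ (D1) ∧ (D4) ∧ CAP+tail; G-an2-4 gates asym, D1 and NE2/3/4. -/
noncomputable section

namespace Summit.QuantumFields.BalabanUV.T4Continuum.NE1p.DressedSmallFieldInnerCount

open Metric Set Complex MeasureTheory
open scoped BigOperators
open Literature.MathematicalPhysics.QuantumFieldTheory.Balaban1983to89 (LocDomainSys)
open Literature.MathematicalPhysics.QuantumFieldTheory.Balaban1983to89.B13 (sum_powerset_le_exp_234)
open Literature.MathematicalPhysics.QuantumFieldTheory.Balaban1983to89.B13FamilySum (coveringFamilies Ineq126 VolBound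
  Ineq229 mem_coveringFamilies ineq229_locDomainSys)
open Literature.MathematicalPhysics.QuantumFieldTheory.Balaban1983to89.T4OutputRate (Carriers)
open Literature.MathematicalPhysics.QuantumFieldTheory.Balaban1983to89.B13Resummation (locE Geometry)
open Summit.QuantumFields.BalabanUV.T4Continuum.B13HistMeasurable (MeasPotFrame B13HistM)
open Summit.QuantumFields.BalabanUV.T4Continuum.B13TermParamGaussianBi (BiCore)
open Summit.QuantumFields.BalabanUV.T4Continuum.NE1p.DressedSmallFieldFamilyCount (prod_family_le count_coveringFamilies
  c₁_pos_of_geometry attachedPart_locE_le_of_coresAt_pencil_count)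

/-! ## §1 THE P-STEP ((2.31) KIND): bond sets outside `Y₀` with `#W ≤ 2·#P`, `W = Z₀∖Y₀` in cubes -/

section PStep

variable {Bnd : Type*} [DecidableEq Bnd]

/-- **THE P-SUM** [arith]: for `0 ≤ s ≤ 1`, `0 ≤ t`, a bond catalogue `B` and a required size `n ≤ 2·#P`:
`Σ_{P ⊆ B, n ≤ 2#P} (s²·t)^{#P} ≤ sⁿ · e^{#B·t}` — two of the factors `s` per bond pay `sⁿ` ((2.31): «Four of them are bounded using
the above inequality, the fifth is used to bound the sum over P», KIND), the rest is b13's `sum_powerset_le_exp_234`. -/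
theorem sum_bondSets_le (B : Finset Bnd) (n : ℕ) {s t : ℝ} (hs0 : 0 ≤ s) (hs1 : s ≤ 1) (ht : 0 ≤ t) :
    ∑ P ∈ B.powerset.filter (fun P => n ≤ 2 * P.card), (s ^ 2 * t) ^ P.card ≤
      s ^ n * Real.exp ((B.card : ℝ) * t) := by
  calc ∑ P ∈ B.powerset.filter (fun P => n ≤ 2 * P.card), (s ^ 2 * t) ^ P.card
      ≤ ∑ P ∈ B.powerset.filter (fun P => n ≤ 2 * P.card), s ^ n * t ^ P.card := by
        refine Finset.sum_le_sum fun P hP => ?_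
        have hn : n ≤ 2 * P.card := (Finset.mem_filter.1 hP).2
        rw [mul_pow, ← pow_mul]
        exact mul_le_mul_of_nonneg_right (pow_le_pow_of_le_one hs0 hs1 hn) (pow_nonneg ht _)
    _ ≤ ∑ P ∈ B.powerset, s ^ n * t ^ P.card :=
        Finset.sum_le_sum_of_subset_of_nonneg (Finset.filter_subset _ _) fun P _ _ => by positivity
    _ = s ^ n * ∑ P ∈ B.powerset, t ^ P.card := by rw [Finset.mul_sum]
    _ ≤ s ^ n * Real.exp ((B.card : ℝ) * t) :=
        mul_le_mul_of_nonneg_left (sum_powerset_le_exp_234 B t ht) (pow_nonneg hs0 _)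

end PStep

/-! ## §2 THE INNER COUNT AT A FIXED `Z₀` ((2.27)∕(2.29) for the family, (2.31) for `P`, (2.32)–(2.34) KIND for `Z₀∖Y₀`) -/

section InnerCount

variable {DomK CubeK Bnd : Type*} [DecidableEq CubeK] [DecidableEq Bnd]

/-- **ONE FIBRE `W = Z₀∖Y₀`** (kernel): the family sum over the coverings of `C₀∖W` (N0s's `count_coveringFamilies` with the
(2.27)∘(2.32)-KIND link `dZ₀ + 5 ≤ Σ_{Y∈𝐃}(d_k Y + 5) + c₃₂·#W`) times the `P`-sum over bond sets of `W` (§1, `#bondsOf W ≤ b₀·#W`) is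
`≤ e^{−R(dZ₀+5)}·u^{#W}` with `u := e^{R c₃₂}·s·e^{b₀ t}`. [folklore] -/
theorem fibre_le (S : Finset DomK) (cubesK : DomK → Finset CubeK) (dK : DomK → ℝ) (bondsOf : Finset CubeK → Finset Bnd)
    (C₀ W : Finset CubeK) {α₆ r R c₃₂ b₀ s t dZ₀ : ℝ} (hα₆ : 0 ≤ α₆) (hR : 0 ≤ R) (hs0 : 0 ≤ s) (hs1 : s ≤ 1) (ht : 0 ≤ t)
    (hb₀ : ((bondsOf W).card : ℝ) ≤ b₀ * W.card)
    (h229 : ∑ Df ∈ coveringFamilies S cubesK (C₀ \ W), ∏ Y ∈ Df, α₆ * Real.exp (-(r * dK Y)) ≤ 1)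
    (hlink : ∀ Df ∈ coveringFamilies S cubesK (C₀ \ W), dZ₀ + 5 ≤ ∑ Y ∈ Df, (dK Y + 5) + c₃₂ * W.card) :
    (∑ Df ∈ coveringFamilies S cubesK (C₀ \ W), ∏ Y ∈ Df, (α₆ * Real.exp (-(r * dK Y)) * Real.exp (-(R * (dK Y + 5))))) *
        (∑ P ∈ (bondsOf W).powerset.filter (fun P => W.card ≤ 2 * P.card), (s ^ 2 * t) ^ P.card) ≤
      Real.exp (-(R * (dZ₀ + 5))) * (Real.exp (R * c₃₂) * s * Real.exp (b₀ * t)) ^ W.card := by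
  have hfam : ∑ Df ∈ coveringFamilies S cubesK (C₀ \ W),
      ∏ Y ∈ Df, (α₆ * Real.exp (-(r * dK Y)) * Real.exp (-(R * (dK Y + 5)))) ≤
      Real.exp (-(R * ((dZ₀ - c₃₂ * W.card) + 5))) :=
    count_coveringFamilies S cubesK dK (C₀ \ W) hα₆ hR h229 (fun Df hDf => by linarith [hlink Df hDf]) subset_rfl
  have hP := sum_bondSets_le (bondsOf W) W.card hs0 hs1 ht
  have hB : Real.exp (((bondsOf W).card : ℝ) * t) ≤ Real.exp (b₀ * t) ^ W.card := by
    rw [← Real.exp_nat_mul]; exact Real.exp_le_exp.2 (by nlinarith)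
  calc _ ≤ Real.exp (-(R * ((dZ₀ - c₃₂ * W.card) + 5))) * (s ^ W.card * Real.exp (((bondsOf W).card : ℝ) * t)) :=
        mul_le_mul hfam hP (Finset.sum_nonneg fun P _ => by positivity) (Real.exp_pos _).le
    _ ≤ Real.exp (-(R * ((dZ₀ - c₃₂ * W.card) + 5))) * (s ^ W.card * Real.exp (b₀ * t) ^ W.card) :=
        mul_le_mul_of_nonneg_left (mul_le_mul_of_nonneg_left hB (pow_nonneg hs0 _)) (Real.exp_pos _).le
    _ = Real.exp (-(R * (dZ₀ + 5))) * (Real.exp (R * c₃₂) * s * Real.exp (b₀ * t)) ^ W.card := by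
        have he : Real.exp (-(R * ((dZ₀ - c₃₂ * W.card) + 5))) =
            Real.exp (-(R * (dZ₀ + 5))) * Real.exp (R * c₃₂) ^ W.card := by
          rw [← Real.exp_nat_mul, ← Real.exp_add]; congr 1; ring
        rw [he, mul_pow, mul_pow]; ring

/-- **THE INNER COUNT AT A FIXED `Z₀`** (kernel; (2.27)∕(2.29)∕(2.31)∕(2.32)–(2.34) KIND, table-blind): labels `⟨W, (𝐃, P)⟩` with
`W ⊆ C₀` (the uncovered cubes `Z₀∖Y₀`), `𝐃` a covering family of `C₀∖W` from the catalogue `S`, `P ⊆ bondsOf W` and the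
minimality clause `#W ≤ 2·#P` (print: `|P| ≥ ½M⁻⁴|Z₀∖Y₀|`, p. 18); for ANY sub-collection `terms` of such labels,
`Σ_{terms} (Π_{Y∈𝐃} α₆e^{−r d_k Y}·e^{−R(d_k Y+5)})·(s²t)^{#P} ≤ e^{−R(dZ₀+5)}·e^{#C₀·u}`, `u := e^{R c₃₂}·s·e^{b₀ t}` — (2.34)'s
`(1 + u)^{#C₀} ≤ e^{#C₀·u}` by b13's `sum_powerset_le_exp_234` BY NAME. [folklore] -/
theorem innerCount_le (S : Finset DomK) (cubesK : DomK → Finset CubeK) (dK : DomK → ℝ) (bondsOf : Finset CubeK → Finset Bnd)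
    (C₀ : Finset CubeK) {α₆ r R c₃₂ b₀ s t dZ₀ : ℝ} (hα₆ : 0 ≤ α₆) (hR : 0 ≤ R) (hs0 : 0 ≤ s) (hs1 : s ≤ 1) (ht : 0 ≤ t)
    (hb₀ : ∀ W ⊆ C₀, ((bondsOf W).card : ℝ) ≤ b₀ * W.card)
    (h229 : ∀ Y₀ ⊆ C₀, ∑ Df ∈ coveringFamilies S cubesK Y₀, ∏ Y ∈ Df, α₆ * Real.exp (-(r * dK Y)) ≤ 1)
    (hlink : ∀ W ⊆ C₀, ∀ Df ∈ coveringFamilies S cubesK (C₀ \ W), dZ₀ + 5 ≤ ∑ Y ∈ Df, (dK Y + 5) + c₃₂ * W.card)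
    {terms : Finset (Σ _ : Finset CubeK, Finset DomK × Finset Bnd)}
    (hadm : ∀ l ∈ terms, l.1 ⊆ C₀ ∧ l.2.1 ∈ coveringFamilies S cubesK (C₀ \ l.1) ∧ l.2.2 ⊆ bondsOf l.1 ∧
      l.1.card ≤ 2 * l.2.2.card) :
    ∑ l ∈ terms, (∏ Y ∈ l.2.1, (α₆ * Real.exp (-(r * dK Y)) * Real.exp (-(R * (dK Y + 5))))) * (s ^ 2 * t) ^ l.2.2.card ≤
      Real.exp (-(R * (dZ₀ + 5))) * Real.exp ((C₀.card : ℝ) * (Real.exp (R * c₃₂) * s * Real.exp (b₀ * t))) := by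
  classical
  set u := Real.exp (R * c₃₂) * s * Real.exp (b₀ * t) with hu
  have hu0 : 0 ≤ u := by positivity
  set adm : Finset (Σ _ : Finset CubeK, Finset DomK × Finset Bnd) := C₀.powerset.sigma fun W =>
    coveringFamilies S cubesK (C₀ \ W) ×ˢ (bondsOf W).powerset.filter (fun P => W.card ≤ 2 * P.card) with hadm_def
  have hsub : terms ⊆ adm := by
    intro l hl
    obtain ⟨h1, h2, h3, h4⟩ := hadm l hl
    exact Finset.mem_sigma.2 ⟨Finset.mem_powerset.2 h1, Finset.mem_product.2 ⟨h2,
      Finset.mem_filter.2 ⟨Finset.mem_powerset.2 h3, h4⟩⟩⟩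
  set f : (Σ _ : Finset CubeK, Finset DomK × Finset Bnd) → ℝ := fun l =>
    (∏ Y ∈ l.2.1, (α₆ * Real.exp (-(r * dK Y)) * Real.exp (-(R * (dK Y + 5))))) * (s ^ 2 * t) ^ l.2.2.card with hf
  have hf0 : ∀ l, 0 ≤ f l := fun l => by positivity
  calc ∑ l ∈ terms, f l ≤ ∑ l ∈ adm, f l := Finset.sum_le_sum_of_subset_of_nonneg hsub fun l _ _ => hf0 l
    _ = ∑ W ∈ C₀.powerset, ∑ q ∈ coveringFamilies S cubesK (C₀ \ W) ×ˢ
          (bondsOf W).powerset.filter (fun P => W.card ≤ 2 * P.card), f ⟨W, q⟩ := Finset.sum_sigma _ _ _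
    _ = ∑ W ∈ C₀.powerset, (∑ Df ∈ coveringFamilies S cubesK (C₀ \ W),
          ∏ Y ∈ Df, (α₆ * Real.exp (-(r * dK Y)) * Real.exp (-(R * (dK Y + 5))))) *
          (∑ P ∈ (bondsOf W).powerset.filter (fun P => W.card ≤ 2 * P.card), (s ^ 2 * t) ^ P.card) := by
        refine Finset.sum_congr rfl fun W _ => ?_
        rw [Finset.sum_product, Finset.sum_mul_sum]
    _ ≤ ∑ W ∈ C₀.powerset, Real.exp (-(R * (dZ₀ + 5))) * u ^ W.card :=
        Finset.sum_le_sum fun W hW => fibre_le S cubesK dK bondsOf C₀ W hα₆ hR hs0 hs1 ht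
          (hb₀ W (Finset.mem_powerset.1 hW)) (h229 _ Finset.sdiff_subset) (hlink W (Finset.mem_powerset.1 hW))
    _ = Real.exp (-(R * (dZ₀ + 5))) * ∑ W ∈ C₀.powerset, u ^ W.card := by rw [Finset.mul_sum]
    _ ≤ Real.exp (-(R * (dZ₀ + 5))) * Real.exp ((C₀.card : ℝ) * u) :=
        mul_le_mul_of_nonneg_left (sum_powerset_le_exp_234 C₀ u hu0) (Real.exp_pos _).le

/-- **THE INNER COUNT WITH ITS DECAY** (kernel; + the additive volume bound `#C₀ ≤ c₁(1 + dZ₀)` of `Z₀`, (2.30) KIND): the count of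
`innerCount_le` is `≤ e^{c₁u − 5R}·e^{−(R − c₁u)·dZ₀}` — print's «The exponential on the right-hand side multiplied by
exp(−δκd_k(Z₀)) can be estimated by 1» (p. 19, KIND): the entropy `e^{#C₀ u}` costs the rate `c₁u`. [folklore] -/
theorem innerCount_le_decay (S : Finset DomK) (cubesK : DomK → Finset CubeK) (dK : DomK → ℝ)
    (bondsOf : Finset CubeK → Finset Bnd) (C₀ : Finset CubeK) {α₆ r R c₃₂ b₀ s t dZ₀ c₁ : ℝ} (hα₆ : 0 ≤ α₆) (hR : 0 ≤ R)
    (hs0 : 0 ≤ s) (hs1 : s ≤ 1) (ht : 0 ≤ t) (hvol : (C₀.card : ℝ) ≤ c₁ * (1 + dZ₀))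
    (hb₀ : ∀ W ⊆ C₀, ((bondsOf W).card : ℝ) ≤ b₀ * W.card)
    (h229 : ∀ Y₀ ⊆ C₀, ∑ Df ∈ coveringFamilies S cubesK Y₀, ∏ Y ∈ Df, α₆ * Real.exp (-(r * dK Y)) ≤ 1)
    (hlink : ∀ W ⊆ C₀, ∀ Df ∈ coveringFamilies S cubesK (C₀ \ W), dZ₀ + 5 ≤ ∑ Y ∈ Df, (dK Y + 5) + c₃₂ * W.card)
    {terms : Finset (Σ _ : Finset CubeK, Finset DomK × Finset Bnd)}
    (hadm : ∀ l ∈ terms, l.1 ⊆ C₀ ∧ l.2.1 ∈ coveringFamilies S cubesK (C₀ \ l.1) ∧ l.2.2 ⊆ bondsOf l.1 ∧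
      l.1.card ≤ 2 * l.2.2.card) :
    ∑ l ∈ terms, (∏ Y ∈ l.2.1, (α₆ * Real.exp (-(r * dK Y)) * Real.exp (-(R * (dK Y + 5))))) * (s ^ 2 * t) ^ l.2.2.card ≤
      Real.exp (c₁ * (Real.exp (R * c₃₂) * s * Real.exp (b₀ * t)) - 5 * R) *
        Real.exp (-((R - c₁ * (Real.exp (R * c₃₂) * s * Real.exp (b₀ * t))) * dZ₀)) := by
  set u := Real.exp (R * c₃₂) * s * Real.exp (b₀ * t) with hu
  have hu0 : 0 ≤ u := by positivity
  refine (innerCount_le S cubesK dK bondsOf C₀ hα₆ hR hs0 hs1 ht hb₀ h229 hlink hadm).trans ?_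
  rw [← Real.exp_add, ← Real.exp_add]
  exact Real.exp_le_exp.2 (by nlinarith [mul_le_mul_of_nonneg_right hvol hu0])

end InnerCount

/-! ## §3 THE END: cores indexed by INNER LABELS `(Z₀∖Y₀, 𝐃, P)` at `Z₀ = foot Z`, the count DISCHARGED by §2 -/

section End

variable {C : Carriers} {P : MeasPotFrame C} {Op : Type*} [NormedAddCommGroup Op] [NormedSpace ℂ Op] {Dk : LocDomainSys}
  {CubeK : Type} [DecidableEq CubeK] {Bnd : Type} [DecidableEq Bnd]
  {𝒴 : ℕ → (Σ _ : Finset CubeK, Finset Dk.Dom × Finset Bnd) → Type*} {dom : ∀ k i, 𝒴 k i → C.Dom}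
  {β : ℕ → (Σ _ : Finset CubeK, Finset Dk.Dom × Finset Bnd) → Type*} [∀ k i, MeasurableSpace (β k i)]
  {α : ℕ → (Σ _ : Finset CubeK, Finset Dk.Dom × Finset Bnd) → Type*} [∀ k i, NormedAddCommGroup (α k i)]
  [∀ k i, InnerProductSpace ℝ (α k i)] [∀ k i, FiniteDimensional ℝ (α k i)] [∀ k i, MeasurableSpace (α k i)]
  [∀ k i, BorelSpace (α k i)]
variable (D : LocDomainSys) {Cube : Type} [DecidableEq Cube] (G : Geometry D Cube) (Gk : Geometry Dk CubeK)

open Classical in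
/-- **THE ATTACHED PART FOR CORES INDEXED BY INNER LABELS, THE SECOND RESUMMATION STEP DISCHARGED** (kernel; N0s's
`attachedPart_locE_le_of_coresAt_pencil_count` ONCE BY NAME at the term index `Σ _ : Finset CubeK, Finset Dk.Dom × Finset Bnd` —
labels `⟨W, (𝐃, P)⟩` of ONE scale-`k` domain `Z₀ = foot Z` (`W = Z₀∖Y₀` in cubes, `𝐃` covering `Gk.cubes (foot Z) ∖ W`, `P ⊆ bondsOf W`,
`#W ≤ 2·#P`: `hadm`) — with the table-blind majorant `(Π_{Y∈𝐃} α₆e^{−δκd_k Y}e^{−R(d_k Y+5)})·(s²t)^{#P}` and `hCount` SUPPLIED by §2's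
`innerCount_le_decay`: (2.29) BY NAME from b13's `ineq229_locDomainSys` on `Gk` (`κ₀ + 1 ≤ δκ`, `e K₀ c₁ α₆ ≤ 1`), the volume bound
`Gk.volBound (foot Z)`, the bonds-per-cube clause `hb₀`, the (2.27)∘(2.32)-KIND link `hlink` (displayed: `d_k(foot Z) + 5 ≤
Σ_{Y∈𝐃}(d_k Y + 5) + c₃₂·#W`; print's (2.32) constant `4`, the tree's repaired `17` for the formalised tree length, G-B13-08), the rate
bookkeeping `Rkp ≤ R − c₁u` (`u := e^{Rc₃₂}·s·e^{b₀t}` — the entropy of the uncovered cubes costs the rate `c₁u`; whence `0 ≤ R` and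
`e^{c₁u−5R} ≤ 1`, the constant being paid by print's `+5` — derived, not binders: crew X152 pre-read (I1)), `hmono`.  Displayed of (B3): `hadm` (the terms of `Z` ARE inner labels of `foot Z` — (B1b) READING, the sub-case
«Z′₀ = Z, one component Z₀»), the per-label AMPLITUDE `hAmp` and the clauses.  Conclusion as N0s's. [folklore] -/
theorem attachedPart_locE_le_of_coresAt_pencil_innerLabels {Win : Set (ℕ → ℝ)}
    {ctr : ℕ → (ℕ → ℝ) → C.BgB → Op × B13HistM P} {ROp RHist R' : ℕ → ℝ}
    (𝔊 : ∀ k i, C.Dom → BiCore P (dom k i) Op (β k i) (α k i))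
    {mq bq N₀ : ℕ → (Σ _ : Finset CubeK, Finset Dk.Dom × Finset Bnd) → C.Dom → ℝ}
    (hroom : ∀ k, ROp k < R' k)
    (hm : ∀ k, ∀ g ∈ Win, ∀ (U : C.BgB) (X : C.Dom), C.scale X = k → ∀ i, 0 < mq k i X)
    (hN : ∀ k, ∀ g ∈ Win, ∀ (U : C.BgB) (X : C.Dom), C.scale X = k → ∀ i,
      (∀ o ∈ ball (ctr k g U).1 (R' k), AEStronglyMeasurable ((𝔊 k i X).N o) (𝔊 k i X).lam) ∧
      (∀ p, DifferentiableOn ℂ (fun o => (𝔊 k i X).N o p) (ball (ctr k g U).1 (R' k))) ∧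
      (∀ o ∈ ball (ctr k g U).1 (R' k), ∀ p, ‖(𝔊 k i X).N o p‖ ≤ N₀ k i X))
    (hq : ∀ k, ∀ g ∈ Win, ∀ (U : C.BgB) (X : C.Dom), C.scale X = k → ∀ i,
      (∀ o ∈ ball (ctr k g U).1 (R' k),
        AEStronglyMeasurable (Function.uncurry ((𝔊 k i X).q o)) ((𝔊 k i X).lam.prod volume)) ∧
      (∀ p v, DifferentiableOn ℂ (fun o => (𝔊 k i X).q o p v) (ball (ctr k g U).1 (R' k))) ∧
      (∀ o ∈ ball (ctr k g U).1 (R' k), ∀ p v, mq k i X * ‖v‖ ^ 2 - bq k i X ≤ ((𝔊 k i X).q o p v).re))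
    {k : ℕ} {g : ℕ → ℝ} (hg : g ∈ Win) {U : C.BgB} {o : Op} {h₀ w : B13HistM P} {ϱ : ℝ}
    (hO : ‖o - (ctr k g U).1‖ ≤ ROp k) (hH : ‖h₀ - (ctr k g U).2‖ + ϱ * ‖w‖ ≤ RHist k)
    {emb : D.Dom → C.Dom} (hscale : ∀ Z, C.scale (emb Z) = k)
    {terms : D.Dom → Finset (Σ _ : Finset CubeK, Finset Dk.Dom × Finset Bnd)} {act : ℂ → D.Dom → ℂ}
    (hact : ∀ σ ∈ ball (0 : ℂ) ϱ, ∀ Z, act σ Z = ∑ i ∈ terms Z, (𝔊 k i (emb Z)).termAt o (h₀ + σ • w))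
    {A₀ A₁ Rkp r₁ b₅ : ℝ} {X₀ : D.Dom} (hA₀ : 0 ≤ A₀) (hA₁ : 0 ≤ A₁) (hr₁ : 0 ≤ r₁) (hb : r₁ * 5 ≤ b₅)
    (hrate : r₁ + 2 * G.κ₀ + 2 ≤ Rkp) (hsmall : (A₀ + ϱ * A₁) * Real.exp (b₅ + 1) * G.K₀ * G.ν * G.c₁ ≤ 1)
    (foot : D.Dom → Dk.Dom) (hmono : ∀ Z, D.dj Z ≤ Dk.dj (foot Z)) (bondsOf : Finset CubeK → Finset Bnd)
    {δ κ α₆ R c₃₂ b₀ s t : ℝ} (hα₆ : 0 ≤ α₆) (hκ : Gk.κ₀ + 1 ≤ δ * κ) (h229 : Real.exp 1 * Gk.K₀ * Gk.c₁ * α₆ ≤ 1)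
    (hs0 : 0 ≤ s) (hs1 : s ≤ 1) (ht : 0 ≤ t) (hb₀ : ∀ W, ((bondsOf W).card : ℝ) ≤ b₀ * W.card)
    (hRR : Rkp ≤ R - Gk.c₁ * (Real.exp (R * c₃₂) * s * Real.exp (b₀ * t)))
    (hlink : ∀ Z, ∀ W ⊆ Gk.cubes (foot Z), ∀ Df ∈ coveringFamilies Finset.univ Gk.cubes (Gk.cubes (foot Z) \ W),
      Dk.dj (foot Z) + 5 ≤ ∑ Y ∈ Df, (Dk.dj Y + 5) + c₃₂ * W.card)
    (hadm : ∀ Z, ∀ l ∈ terms Z, l.1 ⊆ Gk.cubes (foot Z) ∧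
      l.2.1 ∈ coveringFamilies Finset.univ Gk.cubes (Gk.cubes (foot Z) \ l.1) ∧ l.2.2 ⊆ bondsOf l.1 ∧ l.1.card ≤ 2 * l.2.2.card)
    (hAmp : ∀ Z, G.cubes Z ⊆ G.cubes X₀ → ∀ l ∈ terms Z,
      (𝔊 k l (emb Z)).lam.real univ * ((𝔊 k l (emb Z)).wB * N₀ k l (emb Z) * Real.exp (bq k l (emb Z))) *
          (Real.pi / (mq k l (emb Z) / 2)) ^ (Module.finrank ℝ (α k l) / 2 : ℝ) *
        Real.exp ((𝔊 k l (emb Z)).N₁ * (‖h₀‖ + ϱ * ‖w‖)) ≤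
      (A₀ + ϱ * A₁) * ((∏ Y ∈ l.2.1, (α₆ * Real.exp (-(δ * κ * Dk.dj Y)) * Real.exp (-(R * (Dk.dj Y + 5))))) *
        (s ^ 2 * t) ^ l.2.2.card))
    (hϱ : 2 ≤ ϱ) (hϱA : A₀ ≤ ϱ * A₁) :
    ‖locE G.ι G.cubes (act 1) (G.cubes X₀) - locE G.ι G.cubes (act 0) (G.cubes X₀)‖ ≤
      4 * (Real.exp 1 * G.ν * G.c₁ * G.K₀ ^ 2) * A₁ * Real.exp (-(r₁ * D.dj X₀)) := by
  refine attachedPart_locE_le_of_coresAt_pencil_count D G 𝔊 hroom hm hN hq hg hO hH hscale hact hA₀ hA₁ hr₁ hb hrate hsmall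
    (fun _ l => (∏ Y ∈ l.2.1, (α₆ * Real.exp (-(δ * κ * Dk.dj Y)) * Real.exp (-(R * (Dk.dj Y + 5))))) *
      (s ^ 2 * t) ^ l.2.2.card) hAmp (fun Z _ => ?_) hϱ hϱA
  set u := Real.exp (R * c₃₂) * s * Real.exp (b₀ * t) with hu
  have hc₁ : 0 < Gk.c₁ := c₁_pos_of_geometry Gk (foot Z)
  -- rate bookkeeping: `0 ≤ R` and `c₁u ≤ 5R` FOLLOW from `hrate` ∕ `hRR` (crew leaf-02-g14, X152 pre-read (I1))
  have hcu : 0 ≤ Gk.c₁ * u := mul_nonneg hc₁.le (by positivity)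
  have hR : 0 ≤ R := by linarith [G.κ₀_nonneg]
  have h229' : Ineq229 (Finset.univ : Finset Dk.Dom) Gk.cubes Dk.dj α₆ (δ * κ) :=
    ineq229_locDomainSys Dk Gk.cubes Gk.κ₀ Gk.K₀ Gk.c₁ δ κ α₆ 1 Gk.cubes_nonempty Gk.volBound Gk.ineq126 hα₆ zero_le_one hc₁ hκ
      (by linarith)
  have hcount := innerCount_le_decay Finset.univ Gk.cubes Dk.dj bondsOf (Gk.cubes (foot Z)) (r := δ * κ) hα₆ hR hs0 hs1 ht
    (Gk.volBound (foot Z) (Finset.mem_univ _)) (fun W _ => hb₀ W) (fun Y₀ _ => h229' Y₀) (hlink Z) (hadm Z)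
  refine hcount.trans ?_
  rw [← Real.exp_add]
  refine Real.exp_le_exp.2 ?_
  have hd : 0 ≤ D.dj Z := D.dj_nonneg Z
  have hRkp : 0 ≤ Rkp := by linarith [G.κ₀_nonneg]
  have h1 : (R - Gk.c₁ * u) * D.dj Z ≤ (R - Gk.c₁ * u) * Dk.dj (foot Z) :=
    mul_le_mul_of_nonneg_left (hmono Z) (hRkp.trans hRR)
  have h2 : Rkp * D.dj Z ≤ (R - Gk.c₁ * u) * D.dj Z := mul_le_mul_of_nonneg_right hRR hd
  have h3 : Gk.c₁ * u ≤ 5 * R := by linarith [G.κ₀_nonneg]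
  linarith

end End

end Summit.QuantumFields.BalabanUV.T4Continuum.NE1p.DressedSmallFieldInnerCount

end
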